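import Summits.QuantumAdvantage.QuantumAdvantage.Theorems.OddPrimeWalkColumnResolutionCore
import Summits.QuantumAdvantage.QuantumAdvantage.Theorems.OddPrimeWalkFibreTwistBound
import Summits.QuantumAdvantage.QuantumAdvantage.Theorems.OddPrimeWalkBoundedJuntaRung
import Mathlib.Analysis.SpecialFunctions.Trigonometric.Bounds

/-!
# OddPrimeWalk — the COLUMN-RESOLUTION RUNG at `p = 5` (item stmt-QuantumAdvantage-24278 `ColumnResolutionRungFive`), assembly

Route OddPrimeWalk (planner qa-qnc0-p2 g32, ROUND-32 §3bis, PROOF-MC §4/§9); prover qn-prover-3 g20.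

THEOREM `oddPrimeWalk_columnResolutionRungFive` (route-file signature verbatim, `C = 240`): a strategy that reads the input only
through (i) the bits in an arbitrary set `S` and (ii) the counters mod 5 of the classes of a colouring of the remaining bits, all of
whose free classes have `≥ 240·log₂ n` members, wins the u-walk game on at most `θ·2ⁿ` inputs, every `θ > 2/3`, `n ≥ n₀(θ)`.

PROOF.  `OddPrimeWalkColumnResolutionCore.card_fibre_win_le` bounds every fibre `{u|_S = π}` by
`k + 3√6·((1+4ρ^L)^K − 1)·2^{n−|S|}`, `ρ = cos(π/15)`, `L = 240 log₂ n`, given (a) the fibre twist bound (item 24323,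
`oddPrimeWalk_fibreTwistBoundFive`) and (b) a free-phase bound `k` on `n − |S|` coins — supplied by `SignWalk.freePhase_bound`
(item 24332 ⇒ `k = ⌊(2/3+ε)·2^{n−|S|}⌋`).  NUMERICS (`err_le`): `ρ ≤ 223/225` (`cos(π/15) ≤ 223/225`) ⇒ `ρ^240 ≤ 1/8`
⇒ `ρ^L ≤ 8/n³`; with `K ≤ n` (every class represented), `(1+4ρ^L)^K − 1 ≤ e^{32/n²} − 1 ≤ 64/n²`, so the error is `≤ 512/n²`.
Summing over the `≤ 2^{|S|}` fibres: `#WIN ≤ (2/3 + ε + 512/n²)·2ⁿ ≤ θ·2ⁿ`.  Empty free classes are removed first by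
RE-INDEXING the colouring (`reindex`: same free classes, same counters, every class represented).
COROLLARIES (separate files): `LogMultiplicityRungFive` (24270, `S = ∅`), `MultiCounterRungFive` (24257, `S` = small classes).
WHAT THIS IS NOT: (R₁) / item 24200 (high-resolution form systems) untouched; separation NOT moved.
-/

noncomputable section

namespace Summit.QuantumAdvantage.AdviceFreeQNC0

open Finset Literature.Computability.MetaComplexity

namespace ColRes

open HiddenCoins

/-! ### Numerics -/

/-- `0 < cos(π/15)`. -/
theorem rho_pos : 0 < Real.cos (Real.pi / 15) :=
  Real.cos_pos_of_mem_Ioo ⟨by linarith [Real.pi_pos], by linarith [Real.pi_pos]⟩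

/-- `cos(π/15)^240 ≤ 1/8` (from the quadratic bound `cos x ≤ 1 − 2x²/π²`, i.e. `cos(π/15) ≤ 223/225`, as in the tree's
signature-balance file; no decimal expansion of `π`). -/
theorem rho_pow_le : Real.cos (Real.pi / 15) ^ 240 ≤ 1 / 8 := by
  have hc0 := rho_pos.le
  have hc1 : Real.cos (Real.pi / 15) ≤ 223 / 225 := by
    have hπ := Real.pi_pos
    have habs : |Real.pi / 15| ≤ Real.pi := by rw [abs_of_pos (by positivity)]; linarith
    have h := Real.cos_le_one_sub_mul_cos_sq habs
    have e : 1 - 2 / Real.pi ^ 2 * (Real.pi / 15) ^ 2 = (223 / 225 : ℝ) := by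
      field_simp
      ring
    linarith [h, e]
  have h80 : Real.cos (Real.pi / 15) ^ 80 ≤ 1 / 2 := (pow_le_pow_left₀ hc0 hc1 80).trans (by norm_num)
  calc Real.cos (Real.pi / 15) ^ 240 = (Real.cos (Real.pi / 15) ^ 80) ^ 3 := by rw [← pow_mul]
    _ ≤ (1 / 2 : ℝ) ^ 3 := pow_le_pow_left₀ (by positivity) h80 3
    _ = 1 / 8 := by norm_num

/-- `ρ^{240·log₂ n} ≤ 8/n³`. -/
theorem rho_pow_L_le (n : ℕ) (hn : 1 ≤ n) : Real.cos (Real.pi / 15) ^ (240 * Nat.log 2 n) ≤ 8 / (n : ℝ) ^ 3 := by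
  have hc0 := rho_pos.le
  set t := Nat.log 2 n with ht
  have h1 : Real.cos (Real.pi / 15) ^ (240 * t) ≤ (1 / 8 : ℝ) ^ t := by
    rw [pow_mul]; exact pow_le_pow_left₀ (by positivity) rho_pow_le t
  have h2 : (n : ℝ) < (2 : ℝ) ^ (t + 1) := by exact_mod_cast Nat.lt_pow_succ_log_self (by norm_num) n
  have hn0 : (0 : ℝ) < n := by exact_mod_cast hn
  refine h1.trans ?_
  rw [le_div_iff₀ (by positivity)]
  have h3 : (n : ℝ) ^ 3 ≤ ((2 : ℝ) ^ (t + 1)) ^ 3 := pow_le_pow_left₀ hn0.le h2.le 3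
  have e : ((2 : ℝ) ^ (t + 1)) ^ 3 = 8 * 8 ^ t := by
    rw [← pow_mul, show (t + 1) * 3 = 3 + 3 * t from by ring, pow_add, pow_mul]; norm_num
  have h8 : (0 : ℝ) ≤ (1 / 8 : ℝ) ^ t := by positivity
  calc (1 / 8 : ℝ) ^ t * (n : ℝ) ^ 3 ≤ (1 / 8 : ℝ) ^ t * (8 * 8 ^ t) := by rw [← e]; exact mul_le_mul_of_nonneg_left h3 h8
    _ = 8 := by rw [← mul_assoc, mul_comm ((1/8:ℝ)^t), mul_assoc, ← mul_pow]; norm_num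

/-- **The error term**: `3√6·((1 + 4ρ^L)^K − 1) ≤ 512/n²` for `K ≤ n`, `n ≥ 6`, `L = 240 log₂ n`. -/
theorem err_le (n K : ℕ) (hK : K ≤ n) (hn : 6 ≤ n) :
    3 * Real.sqrt 6 * ((1 + 4 * Real.cos (Real.pi / 15) ^ (240 * Nat.log 2 n)) ^ K - 1) ≤ 512 / (n : ℝ) ^ 2 := by
  have hc0 := rho_pos.le
  set δ := Real.cos (Real.pi / 15) ^ (240 * Nat.log 2 n) with hδ
  have hδ0 : 0 ≤ δ := by positivity
  have hδ1 : δ ≤ 8 / (n : ℝ) ^ 3 := rho_pow_L_le n (by omega)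
  have hn' : (6 : ℝ) ≤ n := by exact_mod_cast hn
  have hn0 : (0 : ℝ) < n := by linarith
  have hKn : (K : ℝ) ≤ n := by exact_mod_cast hK
  set x : ℝ := (K : ℝ) * (4 * δ) with hx
  have hx0 : 0 ≤ x := by positivity
  have hx32 : x ≤ 32 / (n : ℝ) ^ 2 := by
    have h1 : x ≤ (n : ℝ) * (4 * (8 / (n : ℝ) ^ 3)) := by
      rw [hx]; gcongr
    refine h1.trans (le_of_eq ?_)
    field_simp
    ring
  have hx1 : x ≤ 1 := by
    refine hx32.trans ?_
    rw [div_le_one (by positivity)]; nlinarith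
  have hpow : (1 + 4 * δ) ^ K ≤ Real.exp x := by
    calc (1 + 4 * δ) ^ K ≤ (Real.exp (4 * δ)) ^ K :=
          pow_le_pow_left₀ (by positivity) (by have := Real.add_one_le_exp (4 * δ); linarith) K
      _ = Real.exp x := by rw [hx, ← Real.exp_nat_mul]
  have hexp : Real.exp x - 1 ≤ 2 * x := by
    have h := Real.abs_exp_sub_one_le (x := x) (by rw [abs_of_nonneg hx0]; exact hx1)
    rw [abs_of_nonneg hx0] at h
    exact (le_abs_self _).trans h
  have h36 : 3 * Real.sqrt 6 ≤ 8 := by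
    nlinarith [Real.sq_sqrt (show (0 : ℝ) ≤ 6 by norm_num), Real.sqrt_nonneg 6, sq_nonneg (3 * Real.sqrt 6 - 8)]
  have h6 : 0 ≤ 3 * Real.sqrt 6 := by positivity
  have hE : (1 + 4 * δ) ^ K - 1 ≤ 64 / (n : ℝ) ^ 2 := by
    have : (1 + 4 * δ) ^ K - 1 ≤ 2 * x := by linarith
    refine this.trans ?_
    calc 2 * x ≤ 2 * (32 / (n : ℝ) ^ 2) := by linarith
      _ = 64 / (n : ℝ) ^ 2 := by ring
  have hE0 : 0 ≤ (1 + 4 * δ) ^ K - 1 := by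
    have : 1 ≤ (1 + 4 * δ) ^ K := one_le_pow₀ (by linarith)
    linarith
  calc 3 * Real.sqrt 6 * ((1 + 4 * δ) ^ K - 1) ≤ 8 * (64 / (n : ℝ) ^ 2) :=
        mul_le_mul h36 hE hE0 (by norm_num)
    _ = 512 / (n : ℝ) ^ 2 := by ring

/-! ### The bound when every class is represented among the free positions -/

/-- **Column resolution, represented classes** (`C = 240`): every class has a free member. -/
theorem card_win_le_repr (θ : ℝ) (hθ : 2 / 3 < θ) : ∃ n₀ : ℕ, ∀ n ≥ n₀, ∀ (c K : ℕ) (S : Finset (Fin n)),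
    (∃ i : Fin n, i ∉ S) → ∀ κ : Fin n → Fin K,
    (∀ i : Fin n, i ∉ S → 240 * Nat.log 2 n ≤ (univ.filter fun i' : Fin n => i' ∉ S ∧ κ i' = κ i).card) →
    (∀ k : Fin K, ∃ i : Fin n, i ∉ S ∧ κ i = k) →
    ∀ y : Fin (n + 1) → (Fin n → Bool) → Bool,
    (∀ g u u', (∀ i ∈ S, u i = u' i) → (∀ k, cntZ S κ u k = cntZ S κ u' k) → y g u = y g u') →
    ((univ.filter fun u : Fin n → Bool => ringWinU c y u = true).card : ℝ) ≤ θ * (2 : ℝ) ^ n := by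
  classical
  set ε : ℝ := (θ - 2 / 3) / 2 with hε
  have hε0 : 0 < ε := by rw [hε]; linarith
  obtain ⟨m₀, hm₀⟩ := SignWalk.freePhase_bound (2 / 3 + ε) (by linarith)
  obtain ⟨N₁, hN₁⟩ := exists_nat_ge (512 / ε)
  refine ⟨max (2 ^ m₀) (max 6 N₁), fun n hn c K S hS κ hL hne y hy => ?_⟩
  have hnm : 2 ^ m₀ ≤ n := le_of_max_le_left hn
  have hn6 : 6 ≤ n := le_of_max_le_left (le_of_max_le_right hn)
  have hnN : N₁ ≤ n := le_of_max_le_right (le_of_max_le_right hn)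
  have hn0 : (0 : ℝ) < n := by exact_mod_cast (show 0 < n by omega)
  -- `K ≤ n`
  have hKn : K ≤ n := by
    have hsub : (univ : Finset (Fin K)) ⊆ (univ.filter fun i : Fin n => i ∉ S).image κ := by
      intro k _
      obtain ⟨i, hi, hk⟩ := hne k
      exact mem_image.mpr ⟨i, by simp [hi], hk⟩
    have h := (card_le_card hsub).trans card_image_le
    rw [card_univ, Fintype.card_fin] at h
    exact h.trans ((card_filter_le _ _).trans (by simp))
  -- the free count
  have hfreeS : (univ.filter fun i' : Fin n => i' ∉ S).card = n - S.card := by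
    have := Finset.card_filter_add_card_filter_not (s := (univ : Finset (Fin n))) (fun i => i ∈ S)
    rw [filter_mem_eq_inter, univ_inter, card_univ, Fintype.card_fin] at this
    omega
  have hfree : 240 * Nat.log 2 n ≤ n - S.card := by
    obtain ⟨i₀, hi₀⟩ := hS
    have h1 := hL i₀ hi₀
    have h2 : (univ.filter fun i' : Fin n => i' ∉ S ∧ κ i' = κ i₀).card ≤ (univ.filter fun i' : Fin n => i' ∉ S).card :=
      card_le_card fun i hi => by
        simp only [mem_filter, mem_univ, true_and] at hi ⊢; exact hi.1
    omega
  have hm₀n : m₀ ≤ n - S.card := by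
    have : m₀ ≤ Nat.log 2 n := Nat.le_log_of_pow_le (by norm_num) hnm
    omega
  have hB := hm₀ (n - S.card) hm₀n
  have hTB : FibreTB n := fun c S π Y β =>
    Summit.QuantumAdvantage.QuantumAdvantage.Theorems.oddPrimeWalk_fibreTwistBoundFive n c S π Y β
  -- per fibre
  set M : ℝ := (2 : ℝ) ^ (n - S.card) with hM
  set E : ℝ := (1 + 4 * Real.cos (Real.pi / 15) ^ (240 * Nat.log 2 n)) ^ K - 1 with hE
  set kB : ℕ := ⌊(2 / 3 + ε) * (2 : ℝ) ^ (n - S.card)⌋₊ with hkB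
  have hfib : ∀ u₁ : Fin n → Bool,
      ((univ.filter fun u : Fin n → Bool => proj S u = proj S u₁ ∧ ringWinU c y u = true).card : ℝ) ≤
        kB + 3 * Real.sqrt 6 * E * M :=
    fun u₁ => card_fibre_win_le S κ y c hTB hy (240 * Nat.log 2 n) hL hne hB u₁
  have herr : 3 * Real.sqrt 6 * E ≤ ε := by
    refine (err_le n K hKn hn6).trans ?_
    have hN : 512 / ε ≤ (n : ℝ) := hN₁.trans (by exact_mod_cast hnN)
    rw [div_le_iff₀ (by positivity)]
    rw [div_le_iff₀ hε0] at hN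
    have hn1 : (1 : ℝ) ≤ n := by exact_mod_cast (show 1 ≤ n by omega)
    nlinarith
  have hkB' : (kB : ℝ) ≤ (2 / 3 + ε) * M := Nat.floor_le (by positivity)
  -- sum over the fibres
  set s := univ.filter fun u : Fin n → Bool => ringWinU c y u = true with hs
  have hdecomp := card_eq_sum_card_image (proj S) s
  have hfib' : ∀ b ∈ s.image (proj S), ((s.filter fun u => proj S u = b).card : ℝ) ≤ kB + 3 * Real.sqrt 6 * E * M := by
    intro b hb
    obtain ⟨u₁, -, rfl⟩ := mem_image.mp hb
    have e : (s.filter fun u => proj S u = proj S u₁) =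
        univ.filter fun u : Fin n → Bool => proj S u = proj S u₁ ∧ ringWinU c y u = true := by
      ext u; simp only [hs, mem_filter, mem_univ, true_and]; exact And.comm
    rw [e]; exact hfib u₁
  have himg : ((s.image (proj S)).card : ℝ) ≤ (2 : ℝ) ^ S.card := by
    exact_mod_cast card_image_proj_le S s
  have hpos : 0 ≤ (kB : ℝ) + 3 * Real.sqrt 6 * E * M := by
    have := hfib' 
    by_cases hne' : (s.image (proj S)).Nonempty
    · obtain ⟨b, hb⟩ := hne'
      exact le_trans (by positivity) (this b hb)
    · -- no fibre: irrelevant, but the quantity is still used below; bound it via `hfib`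
      exact le_trans (by positivity) (hfib (fun _ => false))
  have hSn : S.card ≤ n := by simpa using S.card_le_univ
  have hpow2 : (2 : ℝ) ^ S.card * M = (2 : ℝ) ^ n := by
    rw [hM, ← pow_add, Nat.add_sub_cancel' hSn]
  calc (s.card : ℝ) = ∑ b ∈ s.image (proj S), ((s.filter fun u => proj S u = b).card : ℝ) := by
        rw [hdecomp]; push_cast; rfl
    _ ≤ ∑ _b ∈ s.image (proj S), ((kB : ℝ) + 3 * Real.sqrt 6 * E * M) := sum_le_sum hfib'
    _ = (s.image (proj S)).card * ((kB : ℝ) + 3 * Real.sqrt 6 * E * M) := by rw [sum_const, nsmul_eq_mul]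
    _ ≤ (2 : ℝ) ^ S.card * ((kB : ℝ) + 3 * Real.sqrt 6 * E * M) := mul_le_mul_of_nonneg_right himg hpos
    _ ≤ (2 : ℝ) ^ S.card * ((2 / 3 + ε) * M + ε * M) := by
        refine mul_le_mul_of_nonneg_left ?_ (by positivity)
        have hM0 : 0 ≤ M := by positivity
        nlinarith
    _ = θ * (2 : ℝ) ^ n := by rw [← hpow2, hε]; ring

/-! ### Re-indexing: remove the empty free classes -/

/-- Re-index a colouring so that every class has a free member, keeping the free classes and their counters. -/
theorem reindex (n K : ℕ) (S : Finset (Fin n)) (κ : Fin n → Fin K) (hS : ∃ i : Fin n, i ∉ S) :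
    ∃ K' : ℕ, ∃ κ' : Fin n → Fin K',
      (∀ k' : Fin K', ∃ i : Fin n, i ∉ S ∧ κ' i = k') ∧
      (∀ i i' : Fin n, i ∉ S → i' ∉ S → (κ' i' = κ' i ↔ κ i' = κ i)) ∧
      (∀ u u' : Fin n → Bool, (∀ k', cntZ S κ' u k' = cntZ S κ' u' k') → ∀ k, cntZ S κ u k = cntZ S κ u' k) := by
  classical
  set J : Finset (Fin K) := (univ.filter fun i : Fin n => i ∉ S).image κ with hJ
  obtain ⟨i₀, hi₀⟩ := hS
  have hJmem : ∀ i : Fin n, i ∉ S → κ i ∈ J := fun i hi => mem_image.mpr ⟨i, by simp [hi], rfl⟩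
  have hK'pos : 0 < J.card := card_pos.mpr ⟨κ i₀, hJmem i₀ hi₀⟩
  let e := J.equivFin
  let κ' : Fin n → Fin J.card := fun i => if h : κ i ∈ J then e ⟨κ i, h⟩ else ⟨0, hK'pos⟩
  have hκ' : ∀ i : Fin n, ∀ (h : κ i ∈ J), κ' i = e ⟨κ i, h⟩ := fun i h => by simp only [κ', dif_pos h]
  refine ⟨J.card, κ', ?_, ?_, ?_⟩
  · intro k'
    have hk' : (e.symm k').1 ∈ (univ.filter fun i : Fin n => i ∉ S).image κ := (e.symm k').2
    rw [mem_image] at hk'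
    obtain ⟨i, hi, hik⟩ := hk'
    simp only [mem_filter, mem_univ, true_and] at hi
    refine ⟨i, hi, ?_⟩
    rw [hκ' i (hJmem i hi)]
    have : (⟨κ i, hJmem i hi⟩ : {x // x ∈ J}) = e.symm k' := Subtype.ext hik
    rw [this, Equiv.apply_symm_apply]
  · intro i i' hi hi'
    rw [hκ' i (hJmem i hi), hκ' i' (hJmem i' hi')]
    constructor
    · intro h
      have := e.injective h
      exact congrArg Subtype.val this
    · intro h
      congr 1
      exact Subtype.ext h
  · intro u u' h k
    by_cases hk : k ∈ J
    · have hset : ∀ w : Fin n → Bool, cntZ S κ w k = cntZ S κ' w (e ⟨k, hk⟩) := by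
        intro w
        unfold cntZ
        congr 2
        ext i
        simp only [mem_filter, mem_univ, true_and]
        constructor
        · rintro ⟨hi, hik, hw⟩
          refine ⟨hi, ?_, hw⟩
          rw [hκ' i (hJmem i hi)]
          congr 1; exact Subtype.ext hik
        · rintro ⟨hi, hik, hw⟩
          refine ⟨hi, ?_, hw⟩
          rw [hκ' i (hJmem i hi)] at hik
          exact congrArg Subtype.val (e.injective hik)
      rw [hset u, hset u']
      exact h _
    · have hemp : ∀ w : Fin n → Bool, cntZ S κ w k = 0 := by
        intro w
        unfold cntZ
        rw [Finset.card_eq_zero.mpr, Nat.cast_zero]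
        rw [Finset.filter_eq_empty_iff]
        rintro i - ⟨hi, hik, -⟩
        exact hk (hik ▸ hJmem i hi)
      rw [hemp u, hemp u']

end ColRes

end Summit.QuantumAdvantage.AdviceFreeQNC0

namespace Summit.QuantumAdvantage.QuantumAdvantage.Theorems

open Finset Summit.QuantumAdvantage.AdviceFreeQNC0 Summit.QuantumAdvantage.AdviceFreeQNC0.ColRes

set_option linter.dupNamespace false in
/-- **COLUMN-RESOLUTION RUNG at `p = 5`** (item stmt-QuantumAdvantage-24278 `ColumnResolutionRungFive`, route OddPrimeWalk; the
route file's signature verbatim, with `C = 240`). -/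
theorem oddPrimeWalk_columnResolutionRungFive :
    ∀ θ : ℝ, 2 / 3 < θ → ∃ C n₀ : ℕ, ∀ n ≥ n₀, ∀ c K : ℕ, ∀ S : Finset (Fin n), (∃ i : Fin n, i ∉ S) → ∀ κ : Fin n → Fin K, (∀ i : Fin n, i ∉ S → C * Nat.log 2 n ≤ (Finset.univ.filter fun i' : Fin n => i' ∉ S ∧ κ i' = κ i).card) → ∀ y : Fin (n + 1) → (Fin n → Bool) → Bool, (∀ g u u', (∀ i ∈ S, u i = u' i) → (∀ k : Fin K, ((((Finset.univ.filter fun i : Fin n => i ∉ S ∧ κ i = k ∧ u i = true).card : ℕ) : ZMod 5) = (((Finset.univ.filter fun i : Fin n => i ∉ S ∧ κ i = k ∧ u' i = true).card : ℕ) : ZMod 5))) → y g u = y g u') → ((Finset.univ.filter fun u : Fin n → Bool => Summit.QuantumAdvantage.AdviceFreeQNC0.ringWinU c y u = true).card : ℝ) ≤ θ * (2 : ℝ) ^ n := by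
  intro θ hθ
  obtain ⟨n₀, hn₀⟩ := ColRes.card_win_le_repr θ hθ
  refine ⟨240, n₀, fun n hn c K S hS κ hL y hy => ?_⟩
  obtain ⟨K', κ', hne', hcls, hcnt⟩ := ColRes.reindex n K S κ hS
  refine hn₀ n hn c K' S hS κ' ?_ hne' y ?_
  · intro i hi
    have e : (univ.filter fun i' : Fin n => i' ∉ S ∧ κ' i' = κ' i) = univ.filter fun i' : Fin n => i' ∉ S ∧ κ i' = κ i := by
      ext i'
      simp only [mem_filter, mem_univ, true_and]
      constructor
      · rintro ⟨hi', h⟩; exact ⟨hi', (hcls i i' hi hi').mp h⟩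
      · rintro ⟨hi', h⟩; exact ⟨hi', (hcls i i' hi hi').mpr h⟩
    rw [e]; exact hL i hi
  · intro g u u' hSu hcu
    exact hy g u u' hSu (hcnt u u' hcu)

end Summit.QuantumAdvantage.QuantumAdvantage.Theorems

end
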